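import Summits.QuantumFields.YangMills.Theorems.BalabanUVNodesN16Shape
import Summits.QuantumFields.YangMills.Theorems.BalabanUVNodesN16EndUniform
import HarnessLib

/-!
# Route «BalabanUVNodes» (cluster K4 «SpineRates»), Track-A DAG node N16 = NE3 — TWO FACES OF N16 FOR ITS OUT-EDGES, BY NAME:
# (A) the ACTION half `ActionRate (minActReadings 4 (sfClass 4 L N ε) L N dom loc) C_A (L⁻²)` for EVERY local reading `loc` from N07's interface ALONE;
# (♯) the face T-E_w♯ `NE3EnergyRateWSup 4 (sfClass 4 L N ε) L N b g C s dom` (energy + DECAYING SUP of the pair's direction) from the two in-edge interfaces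

Cell `pub-ymgap`, seat `pub-ymgap-dag-n16-a` (KNIT-BY-NAME, HUMAN RULING D-0062; chair R424 venue), generation 2, file 4.  `bears_on: R4∕N16`.  Filed
`--supports stmt-QuantumFields-19182` (`SpineGivenEndpoint`, K4).  Context: the interface finding of this seat's dossier §7 — the in-tree CONSUMERS of
N16's DECL `T4EtaRateMin.NE3Shape R C θ` read it on carriers other than the ne3 lineage's reading (D): N15's edge of record
`NE2BalabanFinalRateCarriers.balaban_final_rate_of_ne3Shape_anyRate` on `minActReadings d 𝒞 L N dom (ne2Loc …)` (SAME readings constructor, NE2's tower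
entry-reading as `loc`), N19's `core_summable_of_spineNodes` on an abstract `R` under `T4RateLiaison.GaugeDominated`, N21 on the (F∞) width.  What N16 can
hand them BY NAME today:

* §1 **`actionRate_of_leafH3sup_four`** — the `ActionRate` conjunct of `NE3Shape` on `minActReadings 4 (sfClass 4 L N ε) L N dom loc` for EVERY `loc`
  (so in particular for N15's `ne2Loc` reading and for reading (D)), with King-type rate `L⁻²` and a constant `wallConstNA(4,L)(gradConst 4 1 + 1)∕L²`
  depending on `L` only, from N07's interface (H3ˢᵘᵖ) `LeafH3sup 4 L N ε b c dom` ([Balaban1985Variational] Thm 1 (8)+(10) TYPE) + the data class + ONE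
  numeral — route (A) of the ne3 lineage (`MinimalActionThm1Type.actionRate_sfClass_thm1Type`) with (H∃) supplied by `hmin_of_leafH3sup_four` (existence
  by compactness).  Neither N05 nor N16's record is needed for this half.
* §2 **`ne3EnergyRateWSup_of_inEdges`** — the face T-E_w♯ `NE3EnergyWeightedSupShape.NE3EnergyRateWSup` (η-weighted energy `≤ C·residualScale` AND the
  decaying sup `‖Z x κ‖ ≤ s·(L⁻¹)^k` of the SAME pair `(u, Z)`, `U_A^{u} = W·e^{Z}`, `W = rescale L (bavg L U_B)`) over Bałaban's class from the two in-edge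
  interfaces: file 2's `n16_of_inEdges_uniform` (∃ r first) then file 1's bridge `exists_ne3EnergyRateWSup_of_cov`.  The ne3 P1 lineage's END of this face,
  `NE3EnergyRateWSupRoutePiRInv.ne3EnergyRateWSup_sfClass_routePi_rinv` (p247216), was CONDITIONAL on per-pair leaves `hleaves`; here it follows from the
  [B8] Thm 2 + (1.37) ∘ [B11] Thm 1 TYPES alone — the (F∞) TYPE «two-run sup-closeness of consecutive minimisers at rate `L⁻¹`» on the ne3 carriers.

HONEST FRAMING.  Bookkeeping over LANDED theorems by name; nothing of Bałaban's is asserted; the interfaces are printed-TYPE HYPOTHESIS SHAPES not proved on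
the lattice; the dictionary from §2's sup face to the consumers' carriers (consistent gauge tower ∕ transporter entries) is NOT here and is OPEN; **N16 ∕ NE3
is NOT discharged**; one finite four-torus at fixed ε — NOT ℝ⁴, NOT infinite volume, NOT OS, NOT a mass gap, NOT Clay.
-/

set_option autoImplicit false

open scoped BigOperators Matrix Matrix.Norms.L2Operator
open NormedSpace Finset

namespace Summit.QuantumFields.YangMills.BalabanUVNodes.N16

open Literature.MathematicalPhysics.QuantumFieldTheory.Balaban1983to89
open B7Prop1Explicit B7Prop2Explicit
open T4AveragingDeficitWall hiding Site Plane Plaq Bond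
open T4AveragingDeficitNonAbelian (wallConstNA wallConstNA_nonneg)
open T4EtaRateMin (ActionRate)
open Summit.QuantumFields.BalabanUV.T4Continuum
open MinimalActionRate (sfClass minActReadings)
open MinimalActionRefine (gradConst gradConst_nonneg)
open BlockAverageCurrent (curConst)
open NE3EnergyWeightedSupShape (NE3EnergyRateWSup)
open NE3RightInverseSupLetters (frameC)
open NE3.PairLandauB8Avg (PairLandauGaugeB8Avg)
open NE3.LeafIndexSockets (LeafH3sup)
open MinimalActionThm1Type (actionRate_sfClass_thm1Type)
open NE7EtaBackgroundRefineThresholds (thresholds_four classRadius_four)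

noncomputable section

variable {n : Type*} [Fintype n] [DecidableEq n]

/-! ## §1 Face (A): the ACTION half for every local reading, from N07's interface alone -/

/-- **N16's ACTION HALF FOR EVERY LOCAL READING, FROM N07's INTERFACE ALONE** (`d = 4`; `L ≥ 2`, `N ≥ 1`; radii `0 ≤ b, c ≤ t`, ONE numeral
`2^91·L^17·t ≤ 1`, class radius `2^76·L^12·t ≤ ε`, compactness `16·C₀(4)·ε ≤ 3`, `1024·5·8·L²·ε ≤ 1`; data class `dom ⊆ sfClass 4 L N ε₁ 0`, `ε₁ ≤ 1∕4`,
`ε₁ ≤ b`, `4ε₁ ≤ c`): N07's interface `LeafH3sup 4 L N ε b c dom` ([Balaban1985Variational] Thm 1 (8)+(10) TYPE) implies, for EVERY local reading `loc` on any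
site type `X`, `ActionRate (minActReadings 4 (sfClass 4 L N ε) L N dom loc) (wallConstNA(4,L)·(gradConst 4 1 + 1)∕L²) (L⁻²)` — i.e.
`|A_{k+1}(V) − A_k(V)| ≤ C_A·(L⁻²)^k·N⁴` for all `k` and `V ∈ dom`, the `ActionRate` conjunct of `T4EtaRateMin.NE3Shape` on N15's carrier
(`loc := ne2Loc …`) as well as on reading (D).  Route (A) of the ne3 lineage (`MinimalActionThm1Type.actionRate_sfClass_thm1Type`) with (H∃) from
`hmin_of_leafH3sup_four` and the thresholds from `thresholds_four` ∕ `thresholds45_four` ∕ `classRadius_four`.  Neither N05 nor N16's record enters.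
[folklore] -/
theorem actionRate_of_leafH3sup_four [Nonempty n] {L N : ℕ} (hL : 2 ≤ L) (hN : 1 ≤ N) {ε ε₁ b c t : ℝ}
    (hb : 0 ≤ b) (hc : 0 ≤ c) (hbt : b ≤ t) (hct : c ≤ t)
    (hsmall : (2 : ℝ) ^ 91 * (L : ℝ) ^ 17 * t ≤ 1) (hεt : (2 : ℝ) ^ 76 * (L : ℝ) ^ 12 * t ≤ ε)
    (hε1 : 16 * C0 4 * ε ≤ 3) (hε2 : 1024 * (4 + 1) * (4 + 4) * (L : ℝ) ^ 2 * ε ≤ 1)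
    (hε₁ : ε₁ ≤ 1 / 4) (hε₁b : ε₁ ≤ b) (hε₁c : 4 * ε₁ ≤ c)
    {dom : Set (Site 4 → Fin 4 → (Matrix n n ℂ)ˣ)} (hdom : dom ⊆ sfClass 4 L N ε₁ 0) (h3 : LeafH3sup 4 L N ε b c dom)
    {X : Type*} (loc : ℕ → (Site 4 → Fin 4 → (Matrix n n ℂ)ˣ) → X → ℝ) :
    ActionRate (minActReadings 4 (sfClass 4 L N ε) L N dom loc) (wallConstNA 4 L * (gradConst 4 1 + 1) / (L : ℝ) ^ 2) (((L : ℝ) ^ 2)⁻¹) := by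
  have hL1 : 1 ≤ L := le_trans (by norm_num) hL
  have ht0 : 0 ≤ t := hb.trans hbt
  obtain ⟨hT1, hT2, hT3⟩ := thresholds_four hL1 ht0 hsmall
  obtain ⟨hT4, hT5⟩ := thresholds45_four hL1 ht0 hsmall
  exact actionRate_sfClass_thm1Type (d := 4) (n := n) (by norm_num) hL1 hN hb hc hbt hct hT1 hT2 hT3 hT4 hT5 (classRadius_four hL1 ht0 hεt)
    (hmin_of_leafH3sup_four hL hb hc hbt hct hsmall hεt hε1 hε2 hε₁ hε₁b hε₁c hdom h3) loc

/-! ## §2 Face (♯): T-E_w♯ over Bałaban's class from the two in-edge interfaces -/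

/-- **T-E_w♯ OVER BAŁABAN's CLASS FROM THE TWO IN-EDGE INTERFACES** (`d = 4`; `L ≥ 2`, `N ≥ 1`): there is `r > 0` (a function of `(L, N, n)` only) such that
for every regularity letter `g > 0`, all leaf letters `0 ≤ b′, c′` on (Rb) `2¹⁵·5²·8²·L²·b′ ≤ 1` and the `c′`-line, every `0 < ε ≤ r`, `0 ≤ s₁ ≤ r`, `0 ≤ b ≤ ε∕2`
with the k-free averaging condition `512·5·8·L²·b ≤ 1`, every `s₂` and `dom`: N05's interface `PairLandauGaugeB8Avg 4 (sfClass 4 L N ε) L N b g s₁ s₂ 1 dom`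
and N07's interface `LeafH3sup 4 L N ε b′ c′ dom` imply `∃ C s ≥ 0, NE3EnergyRateWSup 4 (sfClass 4 L N ε) L N b g C s dom` — per minimiser pair a unitary periodic
gauge `u` and a skew periodic `Z` with `U_A^{u} = W·e^{Z}`, η-weighted energy `≤ C·residualScale` AND `‖Z x κ‖ ≤ s·(L⁻¹)^k` (the (F∞) TYPE on the ne3
carriers).  File 2's `n16_of_inEdges_uniform` then file 1's `exists_ne3EnergyRateWSup_of_cov` (constant first raised to `max C 0`). [folklore] -/
theorem ne3EnergyRateWSup_of_inEdges [Nonempty n] {L N : ℕ} (hL : 2 ≤ L) (hN : 1 ≤ N) :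
    ∃ r : ℝ, 0 < r ∧ ∀ ⦃g b' c' : ℝ⦄, 0 < g → 0 ≤ b' → 0 ≤ c' →
      2 ^ 15 * ((4 : ℝ) + 1) ^ 2 * ((4 : ℝ) + 4) ^ 2 * (L : ℝ) ^ 2 * b' ≤ 1 →
      23040 * (4 : ℝ) ^ 4 * (frameC 4 L + 4) ^ 3 * (c' + curConst 4 L * b' ^ 2) ≤ 1 →
      ∀ ⦃ε s₁ b : ℝ⦄, 0 < ε → ε ≤ r → 0 ≤ s₁ → s₁ ≤ r → 0 ≤ b → b ≤ ε / 2 → 512 * (4 + 1) * (4 + 4) * (L : ℝ) ^ 2 * b ≤ 1 →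
      ∀ (s₂ : ℝ) {dom : Set (Site 4 → Fin 4 → (Matrix n n ℂ)ˣ)},
        PairLandauGaugeB8Avg 4 (sfClass 4 L N ε) L N b g s₁ s₂ 1 dom →
        LeafH3sup 4 L N ε b' c' dom →
        ∃ C s : ℝ, 0 ≤ C ∧ 0 ≤ s ∧ NE3EnergyRateWSup 4 (sfClass 4 L N ε) L N b g C s dom := by
  obtain ⟨r, hr0, hr⟩ := n16_of_inEdges_uniform (n := n) hL hN
  refine ⟨r, hr0, fun g b' c' hg hb' hc' hRb hcF ε s₁ b hε hεr hs₁ hs₁r hb hbε hbs s₂ dom hB8 h3 => ?_⟩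
  obtain ⟨C, h16⟩ := hr hg hb' hc' hRb hcF hε hεr hs₁ hs₁r hb hbε s₂ hB8 h3
  obtain ⟨s, hs, hsup⟩ := exists_ne3EnergyRateWSup_of_cov hL hN hb hbs hg.le (le_max_right C 0) (h16.mono (le_max_left C 0) le_rfl le_rfl)
  exact ⟨max C 0, s, le_max_right C 0, hs, hsup⟩

end

end Summit.QuantumFields.YangMills.BalabanUVNodes.N16
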